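import Summits.ABC.ABC.Theses.IneffectiveSubspace
import Summits.ABC.ABC.Theorems.IneffectiveSubspaceUniformSadicTowerFourStubTowerOfMixedAt
import Summits.ABC.ABC.Theorems.IneffectiveSubspaceUniformSadicTowerFourStubMixedOfTowerAt
import Summits.ABC.ABC.Theorems.IneffectiveSubspaceUniformSadicTowerFourStubUniformInKIffAbc
import Summits.ABC.ABC.Theorems.IneffectiveSubspaceUniformSadicTowerFourStubPlacesToLevel
import Summits.ABC.ABC.Theorems.IneffectiveSubspaceUniformSadicTowerFourStubOmegaCountedTwo
import Summits.ABC.ABC.Theorems.IneffectiveSubspaceUniformSadicTowerFourStubPrimeHallOfLevelOneTwo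
import Summits.ABC.ABC.Theorems.IneffectiveSubspaceUniformSadicTowerFourNormalForm

/-!
# Line `Sketch` (card `mixed-radical-exchange-map`) for the crux `UniformSadicTowerFour` (stmt-ABC-14937) — lead skeleton

Crux: `Summit.ABC.ABC.Theses.IneffectiveSubspace.UniformSadicTowerFour` — for every `K`, `ε > 0` there is
`C(K, ε)` such that for every set `S` of at most `K` primes and every positive coprime level-4 tower point
`x₁x₂²x₃³x₄⁴ + y₁y₂²y₃³y₄⁴ = z₁z₂²z₃³z₄⁴` one has `∏ zᵢ^i < C · ((∏_{p ∈ S} p) · {∏ xᵢyᵢzᵢ}^S)^(1+ε)`,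
`{m}^S = ∏_{p ∣ m, p ∉ S} p^{v_p(m)}` the `S`-free part.

The line is a MAP (the card says so): it puts the crux in MIXED-RADICAL NORMAL FORM on abc triples —
`Mixed K`: `c < C(K,ε) · M_S(abc)^(1+ε)` for every abc triple and every set `S` of `≤ K` primes, where the
mixed radical `M_S(m) := (∏_{p ∈ S} p) · ∏_{p ∣ m, p ∉ S} p^⌈v_p(m)/4⌉` charges `p` on `S` and the
4-rounded radical off `S` — and records the sandwich / exchange / strata around it. No new definitions:
`M_S`, `Mixed K`, `TowerIneqAt N 1`, `LevelOneRung 2`, `OmegaCountedABC 2` are INLINED in every signature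
(`⌈v/4⌉ = (v + 3) / 4`).

STATE (end of cycle 1, after waves 1–2): ten of the eleven registered stubs are LANDED (`--supports stmt-ABC-14937`)
and (all but `StubLevelOneRungOne`, not needed by the composition) imported above — wave 1: `stub_tower_of_mixed_at` (p96324, normal form ⟹ crux, `S`-wise),
`stub_mixed_of_tower_at` (p96155, crux ⟹ normal form, `S`-wise, optimal lifts), `stub_uniformInK_iff_abc` (p96181,
`K`-free constant ⟺ `ABC`), `stub_placesToLevel` (p96601, Vojta exponent 1 at ONE level `N > 3(1+ε)` ⟹ the mixed
inequality for EVERY `S`, constant free of `S`, exponent `(1+ε)N/(N−3(1+ε))`), `stub_omegaCounted_two` (p97349, abc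
on `ω(abc) ≤ 2` with `C = 2`), `stub_primeHall_of_levelOneTwo` (p96636, level-one rung at `K = 2` ⟹ prime Hall);
wave 2: `stub_normalForm` (crux ⟺ `∀ K, Mixed K`), `stub_cruxZero_iff_levelFour` (`Mixed 0` ⟺ `TowerIneqAt 4 1`),
`stub_levelOneRung_of_mixed` (`Mixed K` ⟹ level-one rung at `K`) — all three in p99470,
`Theorems/IneffectiveSubspaceUniformSadicTowerFourNormalForm.lean` — and `stub_levelOneRung_one` (p100802, the
level-one rung is trivial at `K ≤ 1`).
The ONE remaining sorry is `stub_core` = `∀ K, Mixed K`, which by the landed `stub_normalForm` is EQUIVALENT to the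
crux itself: abc-strength, `K = 0` is Vojta's inequality with exponent 1 on `X_4` (`stub_cruxZero_iff_levelFour`);
implied by `ABC`, nothing weaker is known to give it; the standing disprover (`Cruxes/…/Disproof.lean`, cycle 1)
records the same ("exactly as unkillable as the crux; no stub target to break").

Composition (`UniformSadicTowerFour_of`): `stub_core` + `stub_tower_of_mixed_at`.
-/

noncomputable section

-- `Summit.<Summit>.<Problem>` is the mandated summit-side namespace (CONVENTIONS §2); for the
-- single-conjunct summit `ABC` the two coincide, so the duplicate `ABC.ABC` is deliberate.
set_option linter.dupNamespace false

namespace Summit.ABC.ABC.Theorems.UniformSadicTowerFour.MixedRadical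

open Literature.NumberTheory.DiophantineGeometry (IsABCTriple rad rad_def)
open Summit.ABC.ABC.Theses.IneffectiveSubspace
open scoped BigOperators

/-! ## The one open stub (= the crux in normal form) -/

/-- **stub_core (OPEN; the lead's stub).** The crux in mixed-radical normal form: for every `K`, `ε > 0`
there is `C` with `c < C · ((∏_{p∈S} p) · ∏_{p ∣ abc, p ∉ S} p^⌈v_p(abc)/4⌉)^(1+ε)` for every abc triple
`(a,b,c)` and every set `S` of at most `K` primes. abc-strength (`K = 0`: Vojta exponent 1 on `X_4`);
EQUIVALENT to the crux (landed `stub_normalForm`). -/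
theorem stub_core (K : ℕ) :
    ∀ ε : ℝ, 0 < ε → ∃ C : ℝ, 0 < C ∧ ∀ S : Finset ℕ, S.card ≤ K → (∀ p ∈ S, Nat.Prime p) →
      ∀ a b c : ℕ, IsABCTriple a b c →
        (c : ℝ) < C * ((((∏ p ∈ S, p) *
          ∏ p ∈ (a * b * c).primeFactors \ S, p ^ (((a * b * c).factorization p + 3) / 4) : ℕ) : ℝ)) ^
            (1 + ε) := by
  sorry

/-! ## Composition -/

/-- **The line closes the crux modulo its stubs**: `stub_core` gives the mixed inequality at budget `K`,
and the landed `stub_tower_of_mixed_at` transports it, one `S` at a time and with the same constant, to every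
positive coprime level-4 tower point — the crux, concluded BY NAME. -/
theorem UniformSadicTowerFour_of : UniformSadicTowerFour := by
  intro K ε hε
  obtain ⟨C, hC, hK⟩ := stub_core K ε hε
  exact ⟨C, hC, fun S hcard hS x y z hpos hsum hcop =>
    stub_tower_of_mixed_at hC hε (fun a b c habc => hK S hcard hS a b c habc) x y z hpos hsum hcop⟩

end Summit.ABC.ABC.Theorems.UniformSadicTowerFour.MixedRadical

end
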